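import Summits.BirchSwinnertonDyer.BirchSwinnertonDyer.Theorems.ByReductionTypeAtTwoAdditiveKatoTransportPrintExactAnyImageDoors
import Summits.BirchSwinnertonDyer.BirchSwinnertonDyer.Theorems.ByReductionTypeAtTwoAdditiveKatoTransportSymmetry
import HarnessLib

/-!
# Route ByReductionTypeAtTwo, crux C4″ `AdditivePotMultOverKAtTwo` (stmt-BirchSwinnertonDyer-22618; parent
# `AdditiveRankZeroAtTwo` 19098) — R16, part 5: the DECOMPOSITION doors for the ONE image-free print-exact input —
# Kato's divisibility `ℓ_𝔮(X(W/ℚ_∞)) ≤ ℓ_𝔮(Λ/(L̃))` at EVERY height-one `𝔮 ∌ 2` for the additive split-twist curve `W`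
# (blocks (−1) and (−2), key `γ`, ANY image of `ρ̄_{W,2}`, functional equation in the kernel) with the `ι`-symmetry of
# `X(W/ℚ_∞)` supplied BY NAME from Greenberg's Thm. 1.14 over `ℚ` and over `F` (the tree's two PRINT facts) and the
# twist-decomposition reading `hdec` in LENGTH form — the socket seat t42 GEN 23's kernel `hdec` plugs into (theorems only)

Cell `bsd-2adic`, seat `bsd-2adic-k4-w3` GEN 4. addL2x GEN 16's decomposition door
`AddKatoTwo.lengthAt_selmerDual_le_of_oddBranchInputs_of_decomposition` (p682778; t42 `_fe` twin p686033) is keyed by the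
KEY-`γ` input `KatoOddBranchInputsAtTwoNegOneSplitTwist` (the species carrying the ARM-P reading flag) and carries «`W[2]`
irreducible»; no decomposition door existed for the PRINT-EXACT (key-`γ⁻¹`) species. This file supplies it for the ONE
image-free input of R16 (`KatoOddBranchInputsAtTwoNeg{One,Two}SplitTwistPrintExactAnyImage`, p699785):

* `lengthAt_selmerDual_le_of_oddBranchInputsPrintExactAnyImage_of_decomposition_fe` ((−1)-block, key `γ`): inputs
  `Kato2004.thm12_4` (PRINT), the image-free input, `Greenberg1999_thm114_charIdeal_iota_invariant` and
  `Greenberg1999.thm114_charIdeal_iota_invariant_splitMult_baseChange` (PRINT), a globally minimal model `W'` of the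
  twist (multiplicative at `2`) with a number field `F` over which it is split multiplicative above `2` (intended `ℚ(i)`),
  torsion finitely generated dual data `D_F`, `D'` and the decomposition READING `hdec` in length form
  («`ℓ_𝔮(D_F.X) = ℓ_𝔮(D'.X) + ℓ_𝔮(D.X)` at every height-one `𝔮 ∌ 2`»), an integral multiple `L̃ = 2^m L⁻ ≠ 0`; NO `hirr`,
  NO `hXι`, NO `hLtι`. Proof: length symmetry of `D` (`lengthAt_selmerDual_symm_of_decomposition`, image-free), transported to
  the key-`γ⁻¹` `ι`-twist `D^ι` of `D` (`Kato2004.selmerDualData_exists_involTwist`, `…_lengthAt_inv_eq/_eq_inv`), the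
  length-form key-`γ⁻¹` door `lengthAt_selmerDualContra_le_of_oddBranchInputsPrintExactAnyImage_of_lengthAt_symm_fe` at `ι𝔮`,
  and the functional equation (`Kato2004.lengthAt_quotient_span_eq_comap_invol_of_map_invol_span_eq` with
  `MultOddBranchFE.map_invol_span_eq_of_eq_oddBranchMult_two_of_split`).
* `lengthAt_selmerDual_le_of_oddBranchInputsNegTwoPrintExactAnyImage_of_decomposition_fe` ((−2)-block twin; intended
  `F = ℚ(√−2)`, `W'` a minimal model of `W^{(−2)}`; the (−2) image-free input is a THEOREM modulo the (−1) one by R15,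
  `AddKatoTwoGammaTwist.katoOddBranchInputsNegTwoPrintExactAnyImage_of_negOne`, not imported here).

HONEST FRAMING (D-0036 / D-0054): theorems only — no definition, no named fact, no instance, no `sorry`; route-independent;
CONDITIONAL on the named typed input, `Kato2004.thm12_4` and the two Greenberg PRINT facts (taken as hypotheses BY NAME) and
on the decomposition reading `hdec` (T20 (a); seat t42 GEN 23's lane: `IwasawaSelmerQuadraticLayerDualProofs.lengthAt_eq_add_of_quadraticLayer`
modulo the model identification); types-the-object-of; closes none; nothing booked; BSD is not proved by any of this.
PARTITION: X5@2 additive potentially-multiplicative block, the four split-twist sub-blocks × `p = 2`.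

References: [Kato2004Asterisque] Thm. 12.4 (2) (p. 221), Thm. 12.5 (3) with (12.5.1) (p. 222), §17.3 (p. 273), §17.13
(pp. 279–280); [GreenbergLNM1716] Thm. 1.14 (p. 68), §1 (p. 60), §4 (p. 107); [Greenberg1989] Thm. 2, pp. 101–102;
[MazurTateTeitelbaum1986Invent] §I.17; [Washington1997] §13.2; memo `run/shared/lean/pub/bsd-2adic/k4w3/gen4/VERDICT-22618-k4w3-GEN4.md`.
-/

set_option autoImplicit false
-- the summit's namespace `Summit.BirchSwinnertonDyer.BirchSwinnertonDyer` (Sub = Summit) trips `dupNamespace`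
set_option linter.dupNamespace false

noncomputable section

open scoped Classical MatrixGroups ModularForm NumberField

open Field CongruenceSubgroup WeierstrassCurve IsDedekindDomain Literature.NumberTheory.EllipticCurves
  Literature.NumberTheory.EllipticCurves.ModularForms Literature.NumberTheory.EllipticCurves.IwasawaAlgebra
  Literature.NumberTheory.EllipticCurves.Module

namespace Summit.BirchSwinnertonDyer.BirchSwinnertonDyer.Theorems.AddKatoTwo

/-- **The `ι`-twist carries LENGTH-form symmetry of a key-`γ` dual Selmer datum to the key-`γ⁻¹` one, prime by prime.**
If `ℓ_𝔮(D.X) = ℓ_{ι𝔮}(D.X)`, then for any key-`γ⁻¹` datum `D'` of the same curve `ℓ_𝔮(D'.X) = ℓ_{ι𝔮}(D'.X)`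
(`ℓ_𝔓(D'.X) = ℓ_{ι𝔓}(D.X)`, `Kato2004.selmerDualData_lengthAt_inv_eq`, and `ιι = 1`).
[cite: GreenbergLNM1716, §1 (p. 60)] [cite: Greenberg1989, pp. 101–102 (S^ι)] -/
theorem selmerDualContra_lengthAt_symm_of_lengthAt_symm {p : ℕ} [Fact p.Prime] {W : WeierstrassCurve ℚ} [W.IsElliptic]
    {κ : ZpExtension ℚ p} {γ : absoluteGaloisGroup ℚ} (D : W.SelmerDualData κ γ) (D' : W.SelmerDualData κ γ⁻¹)
    (𝔮 : PrimeSpectrum (IwasawaAlgebra p))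
    (hsym : lengthAt (IwasawaAlgebra p) D.X 𝔮 =
      lengthAt (IwasawaAlgebra p) D.X (PrimeSpectrum.comap (invol p).toRingHom 𝔮)) :
    lengthAt (IwasawaAlgebra p) D'.X 𝔮 =
      lengthAt (IwasawaAlgebra p) D'.X (PrimeSpectrum.comap (invol p).toRingHom 𝔮) := by
  rw [Kato2004.selmerDualData_lengthAt_inv_eq D D' 𝔮,
    Kato2004.selmerDualData_lengthAt_inv_eq D D' (PrimeSpectrum.comap (invol p).toRingHom 𝔮),
    Kato2004.comap_invol_comap_invol]
  exact hsym.symm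

/-- **Decomposition door, (−1)-block, key `γ`, ANY image, FE in the kernel.** `ℓ_𝔮(X(W/ℚ_∞)) ≤ ℓ_𝔮(Λ/(L̃))` at EVERY
height-one `𝔮 ∌ 2` for `W` globally minimal, additive with `W^{(−1)}` split multiplicative at `2`, from: `Kato2004.thm12_4`
(PRINT), the ONE image-free input `KatoOddBranchInputsAtTwoNegOneSplitTwistPrintExactAnyImage`, the two PRINT facts
`Greenberg1999_thm114_charIdeal_iota_invariant` / `…_splitMult_baseChange` applied to a globally minimal model `W'` of the
twist over `ℚ` and over `F` (intended `ℚ(i)`), torsion finitely generated dual data `D_F` (of `W'/F_∞`), `D'` (of `W'/ℚ_∞`),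
the twist-decomposition READING `hdec` in length form (T20 (a)), and an integral multiple `L̃ = 2^m·L⁻ ≠ 0` of the odd
branch. Proof: `lengthAt_selmerDual_symm_of_decomposition` (length symmetry of `D`), `selmerDualContra_lengthAt_symm_of_lengthAt_symm`
(symmetry of the `ι`-twist `D^ι`, `Kato2004.selmerDualData_exists_involTwist`), the key-`γ⁻¹` length-form door
`lengthAt_selmerDualContra_le_of_oddBranchInputsPrintExactAnyImage_of_lengthAt_symm_fe` at `ι𝔮`, and transport back
(`Kato2004.selmerDualData_lengthAt_eq_inv`, functional equation). Print-exact + image-free twin of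
`MultOddBranchFE.lengthAt_selmerDual_le_of_oddBranchInputs_of_decomposition_fe`.
[cite: Kato2004Asterisque, Thm. 12.4 (2) (p. 221), Thm. 12.5 (3) and (12.5.1) (p. 222), §17.3 (p. 273), §17.13 (pp. 279–280)]
[cite: GreenbergLNM1716, Thm. 1.14 (p. 68), §4 (p. 107)] [cite: Greenberg1989, pp. 101–102 (S^ι)]
[cite: MazurTateTeitelbaum1986Invent, §I.17] -/
theorem lengthAt_selmerDual_le_of_oddBranchInputsPrintExactAnyImage_of_decomposition_fe (h12 : Kato2004.thm12_4)
    (hPE : KatoOddBranchInputsAtTwoNegOneSplitTwistPrintExactAnyImage)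
    (h114 : Greenberg1999_thm114_charIdeal_iota_invariant)
    (h114F : Greenberg1999.thm114_charIdeal_iota_invariant_splitMult_baseChange)
    (W : WeierstrassCurve ℚ) [W.IsElliptic] [W.IsGloballyMinimal] [ContinuousSMul ℤ_[2] (W.tateModule 2)]
    {N : ℕ} [NeZero N] (f : CuspForm (Gamma0 N) 2) (κ : ZpExtension ℚ 2) (γ : absoluteGaloisGroup ℚ)
    (hsp : (W.quadraticTwist (-1)).HasSplitMultiplicativeReductionAtPrime 2)
    (hκ : κ.IsCyclotomic) (hγ : κ.IsTopGenerator γ)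
    (hγ' : IsCyclotomicVariable 2 γ) (hf : IsNewformOf (W.quadraticTwist (-1)) f)
    (I : Kato2004.IwasawaH1Data W 2 κ γ) (D : W.SelmerDualData κ γ)
    -- the twist over `ℚ` and over `F`, with the decomposition reading in length form
    (W' : WeierstrassCurve ℚ) [W'.IsElliptic] [W'.IsGloballyMinimal] (hmult' : W'.HasMultiplicativeReductionAtPrime 2)
    (F : Type) [Field F] [NumberField F]
    (hF : ∀ v : HeightOneSpectrum (𝓞 F), (2 : 𝓞 F) ∈ v.asIdeal → (W'.baseChange F).HasSplitMultiplicativeReductionAt v)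
    (κF : ZpExtension F 2) (γF : Field.absoluteGaloisGroup F) (hκF : κF.IsCyclotomic) (hγF : κF.IsTopGenerator γF)
    (DF : (W'.baseChange F).SelmerDualData κF γF) [Module.Finite (IwasawaAlgebra 2) DF.X] (hDF : DF.IsTorsion)
    (D' : W'.SelmerDualData κ γ) [Module.Finite (IwasawaAlgebra 2) D'.X] (hD' : D'.IsTorsion)
    (hdec : ∀ 𝔮 : PrimeSpectrum (IwasawaAlgebra 2), 𝔮.asIdeal.height = 1 →
      PowerSeries.C (2 : ℤ_[2]) ∉ 𝔮.asIdeal →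
      lengthAt (IwasawaAlgebra 2) DF.X 𝔮 = lengthAt (IwasawaAlgebra 2) D'.X 𝔮 + lengthAt (IwasawaAlgebra 2) D.X 𝔮)
    -- the `2`-adic `L`-function side
    (Lt : IwasawaAlgebra 2) (m : ℕ)
    (hLt : iwasawaToPowerSeries 2 Lt =
      PowerSeries.C ((2 : ℚ_[2]) ^ m) * padicLFunctionMinusBranchMult f (1 : ℚ_[2]) 1)
    (hLt0 : Lt ≠ 0)
    (𝔮 : PrimeSpectrum (IwasawaAlgebra 2)) (h𝔮 : 𝔮.asIdeal.height = 1)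
    (hp𝔮 : PowerSeries.C (2 : ℤ_[2]) ∉ 𝔮.asIdeal) :
    lengthAt (IwasawaAlgebra 2) D.X 𝔮 ≤
      lengthAt (IwasawaAlgebra 2) (IwasawaAlgebra 2 ⧸ Ideal.span {Lt}) 𝔮 := by
  haveI : Fact (Nat.Prime 2) := ⟨Nat.prime_two⟩
  have hLtι : (Ideal.span {Lt}).map (invol 2).toRingHom = Ideal.span {Lt} :=
    MultOddBranchFE.map_invol_span_eq_of_eq_oddBranchMult_two_of_split hsp hf hLt
  -- length symmetry of `D` at every height-one prime `∌ 2` (T20 (a) by name + `hdec`)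
  have hsymD : ∀ 𝔭 : PrimeSpectrum (IwasawaAlgebra 2), 𝔭.asIdeal.height = 1 →
      PowerSeries.C ((2 : ℕ) : ℤ_[2]) ∉ 𝔭.asIdeal →
      lengthAt (IwasawaAlgebra 2) D.X 𝔭 =
        lengthAt (IwasawaAlgebra 2) D.X (PrimeSpectrum.comap (invol 2).toRingHom 𝔭) := by
    intro 𝔭 h𝔭 hp𝔭
    have hp𝔭' : PowerSeries.C (2 : ℤ_[2]) ∉ 𝔭.asIdeal := by exact_mod_cast hp𝔭
    exact lengthAt_selmerDual_symm_of_decomposition h114 h114F W' hmult' F hF κF γF hκF hγF DF hDF κ γ hκ hγ D' hD' D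
      hdec 𝔭 h𝔭 hp𝔭'
  -- the key-`γ⁻¹` twist of `D` and its symmetry
  obtain ⟨Dι, e, he, -⟩ := Kato2004.selmerDualData_exists_involTwist (mul_inv_cancel γ) D
  -- the conjugate prime
  set 𝔮' := PrimeSpectrum.comap (invol 2).toRingHom 𝔮 with h𝔮'def
  have h𝔮' : 𝔮'.asIdeal.height = 1 := by rw [h𝔮'def, Kato2004.height_comap_invol]; exact h𝔮
  have hp𝔮' : PowerSeries.C (2 : ℤ_[2]) ∉ 𝔮'.asIdeal := by
    intro h
    apply hp𝔮
    rw [h𝔮'def, PrimeSpectrum.comap_asIdeal, Ideal.mem_comap] at h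
    change invol 2 (PowerSeries.C (2 : ℤ_[2])) ∈ 𝔮.asIdeal at h
    rwa [invol_C] at h
  have hp𝔮'' : PowerSeries.C ((2 : ℕ) : ℤ_[2]) ∉ 𝔮'.asIdeal := by exact_mod_cast hp𝔮'
  have hsymι : lengthAt (IwasawaAlgebra 2) Dι.X 𝔮' =
      lengthAt (IwasawaAlgebra 2) Dι.X (PrimeSpectrum.comap (invol 2).toRingHom 𝔮') :=
    selmerDualContra_lengthAt_symm_of_lengthAt_symm D Dι 𝔮' (hsymD 𝔮' h𝔮' hp𝔮'')
  -- the key-`γ⁻¹` length-form door at `ι𝔮`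
  have hA := lengthAt_selmerDualContra_le_of_oddBranchInputsPrintExactAnyImage_of_lengthAt_symm_fe h12 hPE W f κ γ hsp hκ
    hγ hγ' hf I Dι Lt m hLt hLt0 𝔮' h𝔮' hp𝔮' hsymι
  -- transport back to key `γ` at `𝔮`
  rw [Kato2004.selmerDualData_lengthAt_eq_inv D Dι 𝔮,
    Kato2004.lengthAt_quotient_span_eq_comap_invol_of_map_invol_span_eq hLtι 𝔮]
  exact hA

/-- **Decomposition door, (−2)-block, key `γ`, ANY image, FE in the kernel** — the twin of
`lengthAt_selmerDual_le_of_oddBranchInputsPrintExactAnyImage_of_decomposition_fe` for `W` with `W^{(−2)}` split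
multiplicative at `2`: `W'` a globally minimal model of the twist by `−2` (multiplicative at `2`), `F` a number field over
which it is split multiplicative above `2` (intended `ℚ(√−2)`), the image-free `(−2)` input
`KatoOddBranchInputsAtTwoNegTwoSplitTwistPrintExactAnyImage`, an integral multiple `L̃ = 2^m·L⁻₂ ≠ 0` of the
`ω·χ₂`-branch. [cite: Kato2004Asterisque, Thm. 12.4 (2) (p. 221), Thm. 12.5 (3) and (12.5.1) (p. 222), §17.3 (p. 273), §17.13 (pp. 279–280)]
[cite: GreenbergLNM1716, Thm. 1.14 (p. 68), §4 (p. 107)] [cite: Greenberg1989, pp. 101–102 (S^ι)]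
[cite: MazurTateTeitelbaum1986Invent, §I.17] -/
theorem lengthAt_selmerDual_le_of_oddBranchInputsNegTwoPrintExactAnyImage_of_decomposition_fe (h12 : Kato2004.thm12_4)
    (hPE : KatoOddBranchInputsAtTwoNegTwoSplitTwistPrintExactAnyImage)
    (h114 : Greenberg1999_thm114_charIdeal_iota_invariant)
    (h114F : Greenberg1999.thm114_charIdeal_iota_invariant_splitMult_baseChange)
    (W : WeierstrassCurve ℚ) [W.IsElliptic] [W.IsGloballyMinimal] [ContinuousSMul ℤ_[2] (W.tateModule 2)]
    {N : ℕ} [NeZero N] (f : CuspForm (Gamma0 N) 2) (κ : ZpExtension ℚ 2) (γ : absoluteGaloisGroup ℚ)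
    (hsp : (W.quadraticTwist (-2)).HasSplitMultiplicativeReductionAtPrime 2)
    (hκ : κ.IsCyclotomic) (hγ : κ.IsTopGenerator γ)
    (hγ' : IsCyclotomicVariable 2 γ) (hf : IsNewformOf (W.quadraticTwist (-2)) f)
    (I : Kato2004.IwasawaH1Data W 2 κ γ) (D : W.SelmerDualData κ γ)
    (W' : WeierstrassCurve ℚ) [W'.IsElliptic] [W'.IsGloballyMinimal] (hmult' : W'.HasMultiplicativeReductionAtPrime 2)
    (F : Type) [Field F] [NumberField F]
    (hF : ∀ v : HeightOneSpectrum (𝓞 F), (2 : 𝓞 F) ∈ v.asIdeal → (W'.baseChange F).HasSplitMultiplicativeReductionAt v)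
    (κF : ZpExtension F 2) (γF : Field.absoluteGaloisGroup F) (hκF : κF.IsCyclotomic) (hγF : κF.IsTopGenerator γF)
    (DF : (W'.baseChange F).SelmerDualData κF γF) [Module.Finite (IwasawaAlgebra 2) DF.X] (hDF : DF.IsTorsion)
    (D' : W'.SelmerDualData κ γ) [Module.Finite (IwasawaAlgebra 2) D'.X] (hD' : D'.IsTorsion)
    (hdec : ∀ 𝔮 : PrimeSpectrum (IwasawaAlgebra 2), 𝔮.asIdeal.height = 1 →
      PowerSeries.C (2 : ℤ_[2]) ∉ 𝔮.asIdeal →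
      lengthAt (IwasawaAlgebra 2) DF.X 𝔮 = lengthAt (IwasawaAlgebra 2) D'.X 𝔮 + lengthAt (IwasawaAlgebra 2) D.X 𝔮)
    (Lt : IwasawaAlgebra 2) (m : ℕ)
    (hLt : iwasawaToPowerSeries 2 Lt =
      PowerSeries.C ((2 : ℚ_[2]) ^ m) * padicLFunctionMinusBranchMultTwist f (1 : ℚ_[2]) 1 (-1))
    (hLt0 : Lt ≠ 0)
    (𝔮 : PrimeSpectrum (IwasawaAlgebra 2)) (h𝔮 : 𝔮.asIdeal.height = 1)
    (hp𝔮 : PowerSeries.C (2 : ℤ_[2]) ∉ 𝔮.asIdeal) :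
    lengthAt (IwasawaAlgebra 2) D.X 𝔮 ≤
      lengthAt (IwasawaAlgebra 2) (IwasawaAlgebra 2 ⧸ Ideal.span {Lt}) 𝔮 := by
  haveI : Fact (Nat.Prime 2) := ⟨Nat.prime_two⟩
  have hLtι : (Ideal.span {Lt}).map (invol 2).toRingHom = Ideal.span {Lt} :=
    MultOddBranchFE.map_invol_span_eq_of_eq_oddBranchMultTwist_two_of_split hsp hf hLt
  have hsymD : ∀ 𝔭 : PrimeSpectrum (IwasawaAlgebra 2), 𝔭.asIdeal.height = 1 →
      PowerSeries.C ((2 : ℕ) : ℤ_[2]) ∉ 𝔭.asIdeal →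
      lengthAt (IwasawaAlgebra 2) D.X 𝔭 =
        lengthAt (IwasawaAlgebra 2) D.X (PrimeSpectrum.comap (invol 2).toRingHom 𝔭) := by
    intro 𝔭 h𝔭 hp𝔭
    have hp𝔭' : PowerSeries.C (2 : ℤ_[2]) ∉ 𝔭.asIdeal := by exact_mod_cast hp𝔭
    exact lengthAt_selmerDual_symm_of_decomposition h114 h114F W' hmult' F hF κF γF hκF hγF DF hDF κ γ hκ hγ D' hD' D
      hdec 𝔭 h𝔭 hp𝔭'
  obtain ⟨Dι, e, he, -⟩ := Kato2004.selmerDualData_exists_involTwist (mul_inv_cancel γ) D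
  set 𝔮' := PrimeSpectrum.comap (invol 2).toRingHom 𝔮 with h𝔮'def
  have h𝔮' : 𝔮'.asIdeal.height = 1 := by rw [h𝔮'def, Kato2004.height_comap_invol]; exact h𝔮
  have hp𝔮' : PowerSeries.C (2 : ℤ_[2]) ∉ 𝔮'.asIdeal := by
    intro h
    apply hp𝔮
    rw [h𝔮'def, PrimeSpectrum.comap_asIdeal, Ideal.mem_comap] at h
    change invol 2 (PowerSeries.C (2 : ℤ_[2])) ∈ 𝔮.asIdeal at h
    rwa [invol_C] at h
  have hp𝔮'' : PowerSeries.C ((2 : ℕ) : ℤ_[2]) ∉ 𝔮'.asIdeal := by exact_mod_cast hp𝔮'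
  have hsymι : lengthAt (IwasawaAlgebra 2) Dι.X 𝔮' =
      lengthAt (IwasawaAlgebra 2) Dι.X (PrimeSpectrum.comap (invol 2).toRingHom 𝔮') :=
    selmerDualContra_lengthAt_symm_of_lengthAt_symm D Dι 𝔮' (hsymD 𝔮' h𝔮' hp𝔮'')
  have hA := lengthAt_selmerDualContra_le_of_oddBranchInputsNegTwoPrintExactAnyImage_of_lengthAt_symm_fe h12 hPE W f κ γ
    hsp hκ hγ hγ' hf I Dι Lt m hLt hLt0 𝔮' h𝔮' hp𝔮' hsymι
  rw [Kato2004.selmerDualData_lengthAt_eq_inv D Dι 𝔮,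
    Kato2004.lengthAt_quotient_span_eq_comap_invol_of_map_invol_span_eq hLtι 𝔮]
  exact hA

end Summit.BirchSwinnertonDyer.BirchSwinnertonDyer.Theorems.AddKatoTwo

end
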